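import Summits.Ventures.PercRepro.C041BlockMapEmbed
import Summits.Ventures.PercRepro.C041BlockMapOneExit

/-!
# ROW C-041 — THE TRIANGLE HOST AND ITS LOOPIFIED FORMS ARE CONE HOSTS (p6, gen 36; the base cases of the
reduction CYCLE ⟸ TRIANGLE in block-map form, `C041BlockMapCycle`)

The TRIANGLE HOST `tri` (vertices `Fin 3`, edges `Fin 3`, the edge `i` from `i` to `i + 1`), anchor `0`, exits
`triExit : Unit ⊕ Unit → Fin 3` at `1` and `2`.  CONJECTURE (BLOCK MAP) for the triangle — `ConeHost tri
triExit 0` — is the open core of the row.  The seven hosts with a nonempty set of the triangle's edges turned into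
loops (`loopify`: the loop sits at the first end of the edge) are trees with two exits and loops, hence cone
hosts, by the surgeries: each is the wedge of two one-edge or edgeless hosts (`edgeHost`, `edgeHostR`,
`pairHost`) at their anchors (`Built.wedge`) or the hanging of one at the exit of the other (`Built.hang`,
the inner host having its exits coincident at the hang vertex, `coneHost_const`), with loops added
(`Built.addLoop`) and the exits re-indexed where needed (`Built.reindex`); the stray vertex left behind by the
wedge is removed by `coneHost_of_emb` along an explicit zone embedding of the loopified triangle into the built
host.  The seven theorems `coneHost_tri_L0` … `coneHost_tri_L012` are the base cases of `built_cycle`.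
-/

namespace PercRepro

namespace ZoneZ

namespace MultiExit

open ZoneData Pendant Finset TwoExit TreeClosure

/-! ## The primitive hosts -/

/-- The EDGE HOST: the vertices `false` and `true`, one edge from `false` to `true`. -/
def edgeHost : ZoneData Bool Unit Empty Empty where
  fst := fun _ => false
  snd := fun _ => true
  at₁ := Empty.elim
  at₂ := Empty.elim

/-- The REVERSED EDGE HOST: the vertices `false` and `true`, one edge from `true` to `false`. -/
def edgeHostR : ZoneData Bool Unit Empty Empty where
  fst := fun _ => true
  snd := fun _ => false
  at₁ := Empty.elim
  at₂ := Empty.elim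

/-- The EDGELESS PAIR: the vertices `false` and `true`, no edges. -/
def pairHost : ZoneData Bool Empty Empty Empty where
  fst := Empty.elim
  snd := Empty.elim
  at₁ := Empty.elim
  at₂ := Empty.elim

/-- THE TRIANGLE HOST: the vertices `0`, `1`, `2`; the edge `i` from `i` to `i + 1` (`0 → 1`, `1 → 2`,
`2 → 0`). -/
def tri : ZoneData (Fin 3) (Fin 3) Empty Empty where
  fst := ![0, 1, 2]
  snd := ![1, 2, 0]
  at₁ := Empty.elim
  at₂ := Empty.elim

/-- The exits of the triangle: `inl ()` at the vertex `1`, `inr ()` at the vertex `2` (the anchor is `0`). -/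
def triExit : Unit ⊕ Unit → Fin 3 := Sum.elim (fun _ => 1) fun _ => 2

/-- The anchor of the triangle. -/
theorem tri_fst (i : Fin 3) : tri.fst i = i := by fin_cases i <;> rfl

/-- The bijection `Fin 3 ≃ Option (Unit ⊕ Unit)` sending `0 ↦ some (inl ())`, `1 ↦ none`, `2 ↦ some (inr ())`. -/
def eqL1 : Fin 3 ≃ Option (Unit ⊕ Unit) where
  toFun := ![some (Sum.inl ()), none, some (Sum.inr ())]
  invFun := fun e => match e with
    | some (Sum.inl _) => 0
    | none => 1
    | some (Sum.inr _) => 2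
  left_inv := by decide
  right_inv := by decide

/-! ## `L1`: the loop at the exit `1` — the wedge of two edges at the anchor -/

/-- The host built for `loopify tri 1`: the wedge at the anchors of the edge `0 → 1` and the reversed edge
`2 → 0`, with a loop at `1`. -/
def hostL1 : ZoneData (Bool ⊕ Bool) (Option (Unit ⊕ Unit)) (Empty ⊕ Empty) (Empty ⊕ Empty) :=
  addLoop (wedge edgeHost edgeHostR false false) (Sum.inl true)

/-- The embedding of `loopify tri 1` into `hostL1`. -/
def embL1 : ZoneEmb (loopify tri 1) hostL1 where
  v := ![Sum.inl false, Sum.inl true, Sum.inr true]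
  inj := by decide
  e := eqL1
  t₁ := Equiv.equivOfIsEmpty _ _
  t₂ := Equiv.equivOfIsEmpty _ _
  fst_map := by decide
  snd_map := by decide
  at₁_map := fun x => x.elim
  at₂_map := fun x => x.elim

/-- The built host `hostL1` is a cone host. -/
theorem coneHost_hostL1 :
    ConeHost hostL1 (wexits false false (fun _ : Unit => true) fun _ : Unit => true) (Sum.inl false) :=
  coneHost_of_built (Built.addLoop _ _ _ _ (Built.wedge _ _ _ _ _ _
    (Built.core _ _ _ (coneHost_oneExit _ _ _)) (Built.core _ _ _ (coneHost_oneExit _ _ _))))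

/-- **`loopify tri 1` is a cone host.** -/
theorem coneHost_tri_L1 : ConeHost (loopify tri 1) triExit 0 :=
  coneHost_of_emb embL1 triExit 0 (fun k => by rcases k with ⟨⟩ | ⟨⟩ <;> rfl) rfl coneHost_hostL1


/-! ## Coincident exits at the hang vertex -/

/-- The exits `uplus (fun _ => v) v` of the host to be hung at `v` all sit at `v`. -/
theorem uplus_const {V : Type} (v : V) : uplus (fun _ : Unit => v) v = fun _ : Option Unit => v := by
  funext o
  rcases o with _ | ⟨⟩ <;> rfl

/-- A host with the exits `uplus (fun _ => v) v` (all at `v`) is a cone host. -/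
theorem coneHost_uplus_const {V E U₁ U₂ : Type} (Z : ZoneData V E U₁ U₂) (v a : V) [Fintype E] [DecidableEq E] :
    ConeHost Z (uplus (fun _ : Unit => v) v) a := by
  rw [uplus_const]
  exact coneHost_const Z v a

/-! ## `L0`: the loop at the anchor — the edge `2 → 0` with the edge `1 → 2` hung at `2` -/

/-- The bijection `Fin 3 ≃ Option (Unit ⊕ Unit)` sending `0 ↦ none`, `1 ↦ some (inr ())`, `2 ↦ some (inl ())`. -/
def eqL0 : Fin 3 ≃ Option (Unit ⊕ Unit) where
  toFun := ![none, some (Sum.inr ()), some (Sum.inl ())]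
  invFun := fun e => match e with
    | none => 0
    | some (Sum.inr _) => 1
    | some (Sum.inl _) => 2
  left_inv := by decide
  right_inv := by decide

/-- The host built for `loopify tri 0`: the reversed edge `2 → 0` (anchor `false = 0`, exit `true = 2`) with
the reversed edge `1 → 2` hung at `2`, and a loop at the anchor. -/
def hostL0 : ZoneData (Bool ⊕ Bool) (Option (Unit ⊕ Unit)) (Empty ⊕ Empty) (Empty ⊕ Empty) :=
  addLoop (wedge edgeHostR edgeHostR true false) (Sum.inl false)

/-- The embedding of `loopify tri 0` into `hostL0`. -/
def embL0 : ZoneEmb (loopify tri 0) hostL0 where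
  v := ![Sum.inl false, Sum.inr true, Sum.inl true]
  inj := by decide
  e := eqL0
  t₁ := Equiv.equivOfIsEmpty _ _
  t₂ := Equiv.equivOfIsEmpty _ _
  fst_map := by decide
  snd_map := by decide
  at₁_map := fun x => x.elim
  at₂_map := fun x => x.elim

/-- The built host `hostL0` is a cone host. -/
theorem coneHost_hostL0 :
    ConeHost hostL0 (wexits true false (fun _ : Unit => true) fun _ : Unit => true) (Sum.inl false) :=
  coneHost_of_built (Built.addLoop _ _ _ _ (Built.hang _ _ _ _ _ _ _
    (Built.core _ _ _ (coneHost_uplus_const _ _ _)) (Built.core _ _ _ (coneHost_oneExit _ _ _))))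

/-- **`loopify tri 0` is a cone host.** -/
theorem coneHost_tri_L0 : ConeHost (loopify tri 0) triExit 0 :=
  coneHost_of_emb embL0 triExit 0 (fun k => by rcases k with ⟨⟩ | ⟨⟩ <;> rfl) rfl
    (coneHost_reindex (Equiv.sumComm Unit Unit) coneHost_hostL0)

/-! ## `L2`: the loop at the exit `2` — the edge `0 → 1` with the edge `1 → 2` hung at `1` -/

/-- The bijection `Fin 3 ≃ Option (Unit ⊕ Unit)` sending `0 ↦ some (inl ())`, `1 ↦ some (inr ())`, `2 ↦ none`. -/
def eqL2 : Fin 3 ≃ Option (Unit ⊕ Unit) where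
  toFun := ![some (Sum.inl ()), some (Sum.inr ()), none]
  invFun := fun e => match e with
    | some (Sum.inl _) => 0
    | some (Sum.inr _) => 1
    | none => 2
  left_inv := by decide
  right_inv := by decide

/-- The host built for `loopify tri 2`: the edge `0 → 1` with the edge `1 → 2` hung at `1`, and a loop at `2`. -/
def hostL2 : ZoneData (Bool ⊕ Bool) (Option (Unit ⊕ Unit)) (Empty ⊕ Empty) (Empty ⊕ Empty) :=
  addLoop (wedge edgeHost edgeHost true false) (Sum.inr true)

/-- The embedding of `loopify tri 2` into `hostL2`. -/
def embL2 : ZoneEmb (loopify tri 2) hostL2 where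
  v := ![Sum.inl false, Sum.inl true, Sum.inr true]
  inj := by decide
  e := eqL2
  t₁ := Equiv.equivOfIsEmpty _ _
  t₂ := Equiv.equivOfIsEmpty _ _
  fst_map := by decide
  snd_map := by decide
  at₁_map := fun x => x.elim
  at₂_map := fun x => x.elim

/-- The built host `hostL2` is a cone host. -/
theorem coneHost_hostL2 :
    ConeHost hostL2 (wexits true false (fun _ : Unit => true) fun _ : Unit => true) (Sum.inl false) :=
  coneHost_of_built (Built.addLoop _ _ _ _ (Built.hang _ _ _ _ _ _ _
    (Built.core _ _ _ (coneHost_uplus_const _ _ _)) (Built.core _ _ _ (coneHost_oneExit _ _ _))))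

/-- **`loopify tri 2` is a cone host.** -/
theorem coneHost_tri_L2 : ConeHost (loopify tri 2) triExit 0 :=
  coneHost_of_emb embL2 triExit 0 (fun k => by rcases k with ⟨⟩ | ⟨⟩ <;> rfl) rfl coneHost_hostL2

/-! ## `L01`: loops at `0` and `1` — the edge `2 → 0` wedged with the isolated exit `1` -/

/-- The bijection `Fin 3 ≃ Option (Option (Empty ⊕ Unit))` sending `0 ↦ some none`, `1 ↦ none`,
`2 ↦ some (some (inr ()))`. -/
def eqL01 : Fin 3 ≃ Option (Option (Empty ⊕ Unit)) where
  toFun := ![some none, none, some (some (Sum.inr ()))]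
  invFun := fun e => match e with
    | some none => 0
    | none => 1
    | some (some _) => 2
  left_inv := by decide
  right_inv := by decide

/-- The host built for `loopify (loopify tri 1) 0`: the edgeless pair (anchor `0`, exit `1`) wedged at the
anchors with the reversed edge `2 → 0`, with loops at `0` and `1`. -/
def hostL01 : ZoneData (Bool ⊕ Bool) (Option (Option (Empty ⊕ Unit))) (Empty ⊕ Empty) (Empty ⊕ Empty) :=
  addLoop (addLoop (wedge pairHost edgeHostR false false) (Sum.inl false)) (Sum.inl true)

/-- The embedding of `loopify (loopify tri 1) 0` into `hostL01`. -/
def embL01 : ZoneEmb (loopify (loopify tri 1) 0) hostL01 where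
  v := ![Sum.inl false, Sum.inl true, Sum.inr true]
  inj := by decide
  e := eqL01
  t₁ := Equiv.equivOfIsEmpty _ _
  t₂ := Equiv.equivOfIsEmpty _ _
  fst_map := by decide
  snd_map := by decide
  at₁_map := fun x => x.elim
  at₂_map := fun x => x.elim

/-- The built host `hostL01` is a cone host. -/
theorem coneHost_hostL01 :
    ConeHost hostL01 (wexits false false (fun _ : Unit => true) fun _ : Unit => true) (Sum.inl false) :=
  coneHost_of_built (Built.addLoop _ _ _ _ (Built.addLoop _ _ _ _ (Built.wedge _ _ _ _ _ _
    (Built.core _ _ _ (coneHost_oneExit _ _ _)) (Built.core _ _ _ (coneHost_oneExit _ _ _)))))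

/-- **`loopify (loopify tri 1) 0` is a cone host.** -/
theorem coneHost_tri_L01 : ConeHost (loopify (loopify tri 1) 0) triExit 0 :=
  coneHost_of_emb embL01 triExit 0 (fun k => by rcases k with ⟨⟩ | ⟨⟩ <;> rfl) rfl coneHost_hostL01

/-! ## `L02`: loops at `0` and `2` — the isolated anchor with the edge `1 → 2` hung at the exit `2` -/

/-- The bijection `Fin 3 ≃ Option (Option (Empty ⊕ Unit))` sending `0 ↦ some none`,
`1 ↦ some (some (inr ()))`, `2 ↦ none`. -/
def eqL02 : Fin 3 ≃ Option (Option (Empty ⊕ Unit)) where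
  toFun := ![some none, some (some (Sum.inr ())), none]
  invFun := fun e => match e with
    | some none => 0
    | some (some _) => 1
    | none => 2
  left_inv := by decide
  right_inv := by decide

/-- The host built for `loopify (loopify tri 2) 0`: the edgeless pair (anchor `0`, exit `2`) with the reversed
edge `1 → 2` hung at `2`, with loops at `0` and `2`. -/
def hostL02 : ZoneData (Bool ⊕ Bool) (Option (Option (Empty ⊕ Unit))) (Empty ⊕ Empty) (Empty ⊕ Empty) :=
  addLoop (addLoop (wedge pairHost edgeHostR true false) (Sum.inl false)) (Sum.inl true)

/-- The embedding of `loopify (loopify tri 2) 0` into `hostL02`. -/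
def embL02 : ZoneEmb (loopify (loopify tri 2) 0) hostL02 where
  v := ![Sum.inl false, Sum.inr true, Sum.inl true]
  inj := by decide
  e := eqL02
  t₁ := Equiv.equivOfIsEmpty _ _
  t₂ := Equiv.equivOfIsEmpty _ _
  fst_map := by decide
  snd_map := by decide
  at₁_map := fun x => x.elim
  at₂_map := fun x => x.elim

/-- The built host `hostL02` is a cone host. -/
theorem coneHost_hostL02 :
    ConeHost hostL02 (wexits true false (fun _ : Unit => true) fun _ : Unit => true) (Sum.inl false) :=
  coneHost_of_built (Built.addLoop _ _ _ _ (Built.addLoop _ _ _ _ (Built.hang _ _ _ _ _ _ _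
    (Built.core _ _ _ (coneHost_uplus_const _ _ _)) (Built.core _ _ _ (coneHost_oneExit _ _ _)))))

/-- **`loopify (loopify tri 2) 0` is a cone host.** -/
theorem coneHost_tri_L02 : ConeHost (loopify (loopify tri 2) 0) triExit 0 :=
  coneHost_of_emb embL02 triExit 0 (fun k => by rcases k with ⟨⟩ | ⟨⟩ <;> rfl) rfl
    (coneHost_reindex (Equiv.sumComm Unit Unit) coneHost_hostL02)

/-! ## `L12`: loops at `1` and `2` — the edge `0 → 1` wedged with the isolated exit `2` -/

/-- The bijection `Fin 3 ≃ Option (Option (Unit ⊕ Empty))` sending `0 ↦ some (some (inl ()))`,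
`1 ↦ some none`, `2 ↦ none`. -/
def eqL12 : Fin 3 ≃ Option (Option (Unit ⊕ Empty)) where
  toFun := ![some (some (Sum.inl ())), some none, none]
  invFun := fun e => match e with
    | some (some _) => 0
    | some none => 1
    | none => 2
  left_inv := by decide
  right_inv := by decide

/-- The host built for `loopify (loopify tri 2) 1`: the edge `0 → 1` wedged at the anchors with the edgeless
pair (anchor `0`, exit `2`), with loops at `1` and `2`. -/
def hostL12 : ZoneData (Bool ⊕ Bool) (Option (Option (Unit ⊕ Empty))) (Empty ⊕ Empty) (Empty ⊕ Empty) :=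
  addLoop (addLoop (wedge edgeHost pairHost false false) (Sum.inl true)) (Sum.inr true)

/-- The embedding of `loopify (loopify tri 2) 1` into `hostL12`. -/
def embL12 : ZoneEmb (loopify (loopify tri 2) 1) hostL12 where
  v := ![Sum.inl false, Sum.inl true, Sum.inr true]
  inj := by decide
  e := eqL12
  t₁ := Equiv.equivOfIsEmpty _ _
  t₂ := Equiv.equivOfIsEmpty _ _
  fst_map := by decide
  snd_map := by decide
  at₁_map := fun x => x.elim
  at₂_map := fun x => x.elim

/-- The built host `hostL12` is a cone host. -/
theorem coneHost_hostL12 :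
    ConeHost hostL12 (wexits false false (fun _ : Unit => true) fun _ : Unit => true) (Sum.inl false) :=
  coneHost_of_built (Built.addLoop _ _ _ _ (Built.addLoop _ _ _ _ (Built.wedge _ _ _ _ _ _
    (Built.core _ _ _ (coneHost_oneExit _ _ _)) (Built.core _ _ _ (coneHost_oneExit _ _ _)))))

/-- **`loopify (loopify tri 2) 1` is a cone host.** -/
theorem coneHost_tri_L12 : ConeHost (loopify (loopify tri 2) 1) triExit 0 :=
  coneHost_of_emb embL12 triExit 0 (fun k => by rcases k with ⟨⟩ | ⟨⟩ <;> rfl) rfl coneHost_hostL12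

/-! ## `L012`: three loops — the two edgeless pairs wedged at the anchors -/

/-- The bijection `Fin 3 ≃ Option (Option (Option (Empty ⊕ Empty)))` sending `0 ↦ some (some none)`,
`1 ↦ some none`, `2 ↦ none`. -/
def eqL012 : Fin 3 ≃ Option (Option (Option (Empty ⊕ Empty))) where
  toFun := ![some (some none), some none, none]
  invFun := fun e => match e with
    | some (some _) => 0
    | some none => 1
    | none => 2
  left_inv := by decide
  right_inv := by decide

/-- The host built for `loopify (loopify (loopify tri 2) 1) 0`: two edgeless pairs wedged at the anchors, with
loops at `0`, `1` and `2`. -/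
def hostL012 : ZoneData (Bool ⊕ Bool) (Option (Option (Option (Empty ⊕ Empty)))) (Empty ⊕ Empty)
    (Empty ⊕ Empty) :=
  addLoop (addLoop (addLoop (wedge pairHost pairHost false false) (Sum.inl false)) (Sum.inl true)) (Sum.inr true)

/-- The embedding of `loopify (loopify (loopify tri 2) 1) 0` into `hostL012`. -/
def embL012 : ZoneEmb (loopify (loopify (loopify tri 2) 1) 0) hostL012 where
  v := ![Sum.inl false, Sum.inl true, Sum.inr true]
  inj := by decide
  e := eqL012
  t₁ := Equiv.equivOfIsEmpty _ _
  t₂ := Equiv.equivOfIsEmpty _ _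
  fst_map := by decide
  snd_map := by decide
  at₁_map := fun x => x.elim
  at₂_map := fun x => x.elim

/-- The built host `hostL012` is a cone host. -/
theorem coneHost_hostL012 :
    ConeHost hostL012 (wexits false false (fun _ : Unit => true) fun _ : Unit => true) (Sum.inl false) :=
  coneHost_of_built (Built.addLoop _ _ _ _ (Built.addLoop _ _ _ _ (Built.addLoop _ _ _ _ (Built.wedge _ _ _ _ _ _
    (Built.core _ _ _ (coneHost_oneExit _ _ _)) (Built.core _ _ _ (coneHost_oneExit _ _ _))))))

/-- **`loopify (loopify (loopify tri 2) 1) 0` is a cone host.** -/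
theorem coneHost_tri_L012 : ConeHost (loopify (loopify (loopify tri 2) 1) 0) triExit 0 :=
  coneHost_of_emb embL012 triExit 0 (fun k => by rcases k with ⟨⟩ | ⟨⟩ <;> rfl) rfl coneHost_hostL012

end MultiExit

end ZoneZ

end PercRepro
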